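import Literature.AlgebraicTopology.SingularHomology.GysinMapSupportProofs
import Literature.AlgebraicTopology.SingularHomology.LocalHomologyOfSetTransfer
import Literature.AlgebraicTopology.SingularHomology.KroneckerInjectiveSelfInjective
import Literature.AlgebraicTopology.SingularHomology.IntegralClassRingChange
import HarnessLib

/-!
# Gysin maps of degree-one maps over a homeomorphism locus: `f^* f_! y = y` near every compact
# subset of `f⁻¹U`, and on all of `f⁻¹U` modulo `m`

Topic `Literature/AlgebraicTopology/SingularHomology` (theorems only). Let `f : Y → X` be a
continuous map of closed `R`-oriented topological `n`-manifolds of DEGREE ONE (`f_* [Y] = [X]`,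
`HasDegree μY μX f 1`) which restricts to a homeomorphism `f⁻¹U ≃ U` over an open `U ⊆ X` — the
topological shadow of a proper birational morphism `σ : X' → X` of smooth projective varieties and
its isomorphism locus `U`. In Borel–Moore homology the proper push-forward commutes with
restriction to `U` (W. Fulton, *Young Tableaux* (1997), App. B §B.2 (26), (30), Exercise 5;
*Intersection Theory* (1998), §19.1 "evident compatibilities", Lemma 19.1.2), so that over `U` the
Gysin map `f_! = D_X⁻¹ f_* D_Y` (`GysinMap.lean`) of `f` is the Gysin map of the homeomorphism
`f|_{f⁻¹U}`, i.e. transport of classes: **`(f^* f_! y)|_{f⁻¹U} = y|_{f⁻¹U}`**. The tree has no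
Borel–Moore homology; this file proves the statement on singular chains:

* `injective_relMap_of_homeomorph_preimage` — for a closed `C ⊆ f⁻¹U`,
  `f_* : H_q(Y, Y ∖ C) → H_q(X, X ∖ f C)` is injective (excision down to `f⁻¹U ⊇ C` and
  `U ⊇ f C`, `localHomologyOfSet.isIso_map_subsetIncl_of_isClosed`, and the homeomorphism of pairs);
* `exists_isOpen_map_sub_map_gysinMap_eq_zero` — **ANY coefficient ring `R`: for `y ∈ Hᵖ(Y; R)`
  and every compact `C ⊆ f⁻¹U`, the class `κ = y - f^*(f_! y)` vanishes on an open neighbourhood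
  of `C`.** Indeed `f_! κ = f_! y - (f_! f^*)(f_! y) = 0` (projection formula with `deg f = 1`,
  `gysinMap_map_of_hasDegree`), so `f_*(κ ⌢ [Y]) = (f_! κ) ⌢ [X] = 0` (`capProduct_gysinMap`),
  hence `j_*(κ ⌢ [Y]) = 0 ∈ H_q(Y, Y ∖ C)` by the injectivity above, and `κ` dies near `C` by
  Čech–Poincaré duality along `C` (`exists_isOpen_map_eq_zero_of_ofAbsolute_capProduct_eq_zero`,
  Hatcher Thm. 3.44 / Miller Thm. 37.1).

* `singularCohomology.eq_zero_of_forall_isCompact_exists_isOpen_map_eq_zero`,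
  `singularCohomology.map_subsetIncl_eq_zero_of_forall_isCompact` — over a SELF-INJECTIVE ring
  (`Module.Baer R R`: fields, `ℤ/m`) a class vanishing near every compact subset (of a subset `W`)
  vanishes (on `W`): homology classes have compact carriers and the Kronecker map is injective
  (`KroneckerInjectiveSelfInjective.lean`). Over `ℤ` this fails (`Ext`/`lim¹` terms).
* `map_sub_map_gysinMap_eq_zero_of_baer` — **`(y - f^* f_! y)|_{f⁻¹U} = 0` for `R`-orientations
  over a self-injective `R`;**
* `ringChange_map_sub_map_gysinMap_eq_zero` — **integral form modulo `m`: for `ℤ`-orientations and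
  `y ∈ Hᵖ(Y; ℤ)`, the reduction modulo `m` of `y - f^* f_! y` vanishes on `f⁻¹U`** (`m ≠ 0`) — so
  `y - f^* f_! y` is divisible by `m` on `f⁻¹U` for every `m` (Bockstein), which is what the generic
  divisibility questions of `Summits/HodgeConjecture` (route GenericDivisibility) consume.

## References

* [FultonYoungTableaux1997] W. Fulton, Young Tableaux, CUP 1997, App. B §B.1 (5)–(7), §B.2 (26),
  (30), Exercise 5.
* [Fulton1998] W. Fulton, Intersection Theory, 2nd ed. 1998, §19.1, Lemma 19.1.2.
* [HatcherAT2002] A. Hatcher, Algebraic Topology, CUP 2002, Thm. 2.20, §3.3 Thm. 3.30, Thm. 3.44.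
* [Miller2020] H. Miller, Lectures on Algebraic Topology, World Scientific 2020, Thm. 37.1.
-/

noncomputable section

open CategoryTheory Limits Set

universe u v

namespace Literature.AlgebraicTopology.SingularHomology

variable {R : Type v} [CommRing R]
variable {X Y : Type u} [TopologicalSpace X] [TopologicalSpace Y]

/-! ### Relative homology through a map which is a homeomorphism over an open set -/

section Excision

variable {M : Type v} [AddCommGroup M] [Module R M]

/-- Maps of pairs with equal underlying maps induce the same map. [folklore] -/
private theorem relMap_congr {A : Set X} {B : Set Y} {f g : C(X, Y)} (e : f = g)
    (hf : MapsTo f A B) (hg : MapsTo g A B) (q : ℕ) :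
    relativeSingularHomology.map R M f hf q = relativeSingularHomology.map R M g hg q := by
  subst e
  rfl

/-- A `ModuleCat` isomorphism is a bijection. [folklore] -/
private theorem bijective_of_isIso' {A B : ModuleCat.{max u v} R} (φ : A ⟶ B) [IsIso φ] :
    Function.Bijective φ :=
  (asIso φ).toLinearEquiv.bijective

/-- If `f : Y → X` restricts to a homeomorphism `e : f⁻¹U ≃ₜ U` (on points, `e y = f y`) then
`f` maps `Y ∖ C` into `X ∖ f C` for every `C ⊆ f⁻¹U` (`f` is injective over `U`). [folklore] -/
theorem mapsTo_compl_image_of_homeomorph_preimage (f : C(Y, X)) {U : Set X}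
    (e : ↥(f ⁻¹' U) ≃ₜ ↥U) (he : ∀ y : ↥(f ⁻¹' U), ((e y : ↥U) : X) = f y) {C : Set Y}
    (hCU : C ⊆ f ⁻¹' U) : MapsTo f Cᶜ (f '' C)ᶜ := by
  intro y hy ⟨c, hc, hcy⟩
  have hyU : f y ∈ U := by rw [← hcy]; exact hCU hc
  have h1 : e ⟨y, hyU⟩ = e ⟨c, hCU hc⟩ := Subtype.ext (by rw [he, he]; exact hcy.symm)
  have h2 : y = c := congrArg Subtype.val (e.injective h1)
  exact hy (h2 ▸ hc)

/-- **`f_* : H_q(Y, Y ∖ C) → H_q(X, X ∖ f C)` is injective for a closed `C ⊆ f⁻¹U` when `f`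
restricts to a homeomorphism `f⁻¹U ≃ U` over the open `U`** (and `f C` is closed): excise down to
the open neighbourhoods `f⁻¹U ⊇ C`, `U ⊇ f C` (Hatcher Thm. 2.20, the tree's
`localHomologyOfSet.isIso_map_subsetIncl_of_isClosed`) and use the homeomorphism of pairs
`(f⁻¹U, f⁻¹U ∖ C) ≃ (U, U ∖ f C)`. (It is in fact bijective.) [cite: HatcherAT2002, Thm. 2.20] -/
theorem injective_relMap_of_homeomorph_preimage (f : C(Y, X)) {U : Set X} (hU : IsOpen U)
    (e : ↥(f ⁻¹' U) ≃ₜ ↥U) (he : ∀ y : ↥(f ⁻¹' U), ((e y : ↥U) : X) = f y) {C : Set Y}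
    (hC : IsClosed C) (hCU : C ⊆ f ⁻¹' U) (hfC : IsClosed (f '' C)) (q : ℕ) :
    Function.Injective (relativeSingularHomology.map R M f
      (mapsTo_compl_image_of_homeomorph_preimage f e he hCU) q) := by
  have hΩ'o : IsOpen (f ⁻¹' U) := hU.preimage f.continuous
  have hKU : f '' C ⊆ U := by rintro _ ⟨c, hc, rfl⟩; exact hCU hc
  -- the two excision isomorphisms
  haveI hexc' := localHomologyOfSet.isIso_map_subsetIncl_of_isClosed R M hΩ'o hC hCU q
  haveI hexc := localHomologyOfSet.isIso_map_subsetIncl_of_isClosed R M hU hfC hKU q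
  -- `e` as a map of pairs `(f⁻¹U, f⁻¹U ∖ C) → (U, U ∖ f C)`, and its inverse
  have heC : MapsTo (e : C(↥(f ⁻¹' U), ↥U)) ((Subtype.val ⁻¹' C : Set ↥(f ⁻¹' U))ᶜ)
      ((Subtype.val ⁻¹' (f '' C) : Set ↥U)ᶜ) := by
    intro y hy ⟨c, hc, hcy⟩
    have h1 : e y = e ⟨c, hCU hc⟩ := Subtype.ext (hcy.symm.trans (he ⟨c, hCU hc⟩).symm)
    exact hy (show (y : Y) ∈ C by rw [e.injective h1]; exact hc)
  have heC' : MapsTo (e.symm : C(↥U, ↥(f ⁻¹' U))) ((Subtype.val ⁻¹' (f '' C) : Set ↥U)ᶜ)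
      ((Subtype.val ⁻¹' C : Set ↥(f ⁻¹' U))ᶜ) := by
    intro x hx hxC
    refine hx ⟨(e.symm x : Y), hxC, ?_⟩
    have h1 := he (e.symm x)
    rw [e.apply_symm_apply] at h1
    exact h1.symm
  have hee : (e.symm : C(↥U, ↥(f ⁻¹' U))).comp (e : C(↥(f ⁻¹' U), ↥U)) = ContinuousMap.id _ :=
    e.symm_comp_toContinuousMap
  have hinj_e : Function.Injective
      (relativeSingularHomology.map R M (e : C(↥(f ⁻¹' U), ↥U)) heC q) := by
    intro a b hab
    have h := congrArg (relativeSingularHomology.map R M (e.symm : C(↥U, ↥(f ⁻¹' U))) heC' q) hab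
    rwa [← ModuleCat.comp_apply, ← ModuleCat.comp_apply, ← relativeSingularHomology.map_comp,
      relMap_congr hee (heC'.comp heC) (mapsTo_id _) q, relativeSingularHomology.map_id,
      ModuleCat.id_apply, ModuleCat.id_apply] at h
  -- the commutative square `exc' ≫ f_* = e_* ≫ exc`
  have hfe : f.comp (subsetIncl (f ⁻¹' U)) = (subsetIncl U).comp (e : C(↥(f ⁻¹' U), ↥U)) := by
    ext y
    change f y = ((e y : ↥U) : X)
    exact (he y).symm
  have hsq : relativeSingularHomology.map R M (subsetIncl (f ⁻¹' U))
        (localHomologyOfSet.mapsTo_val_compl (f ⁻¹' U) C) q ≫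
      relativeSingularHomology.map R M f (mapsTo_compl_image_of_homeomorph_preimage f e he hCU) q =
      relativeSingularHomology.map R M (e : C(↥(f ⁻¹' U), ↥U)) heC q ≫
        relativeSingularHomology.map R M (subsetIncl U)
          (localHomologyOfSet.mapsTo_val_compl U (f '' C)) q := by
    rw [← relativeSingularHomology.map_comp, ← relativeSingularHomology.map_comp]
    exact relMap_congr hfe _ _ q
  -- conclude
  intro a b hab
  obtain ⟨a₀, rfl⟩ := (bijective_of_isIso' (relativeSingularHomology.map R M (subsetIncl (f ⁻¹' U))
    (localHomologyOfSet.mapsTo_val_compl (f ⁻¹' U) C) q)).2 a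
  obtain ⟨b₀, rfl⟩ := (bijective_of_isIso' (relativeSingularHomology.map R M (subsetIncl (f ⁻¹' U))
    (localHomologyOfSet.mapsTo_val_compl (f ⁻¹' U) C) q)).2 b
  rw [← ModuleCat.comp_apply, ← ModuleCat.comp_apply, hsq, ModuleCat.comp_apply,
    ModuleCat.comp_apply] at hab
  have h1 := (bijective_of_isIso' (relativeSingularHomology.map R M (subsetIncl U)
    (localHomologyOfSet.mapsTo_val_compl U (f '' C)) q)).1 hab
  rw [hinj_e h1]

end Excision

/-! ### Degree-one maps: `y - f^* f_! y` vanishes near every compact subset of `f⁻¹U` -/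

section DegreeOne

variable {n : ℕ} [CompactSpace X] [T2Space X] [ChartedSpace (EuclideanSpace ℝ (Fin n)) X]
  [CompactSpace Y] [T2Space Y] [ChartedSpace (EuclideanSpace ℝ (Fin n)) Y]

omit [CompactSpace Y] [T2Space Y] [ChartedSpace (EuclideanSpace ℝ (Fin n)) Y] in
/-- **`f_! (y - f^* f_! y) = 0` for `f` of degree one** (`f_! f^* = deg f = 1`, Fulton App. B
§B.1 (6)–(7); the tree's `gysinMap_map_of_hasDegree`). [cite: FultonYoungTableaux1997, Appendix B §B.1 (6)–(7)] -/
theorem gysinMap_sub_map_gysinMap_eq_zero (μY : HomologicalOrientation R Y n)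
    (μX : HomologicalOrientation R X n) (f : C(Y, X)) (hf : HasDegree μY μX f 1) {p q : ℕ}
    (h : p + q = n) (y : singularCohomology R R Y p) :
    gysinMap μY μX f h h (y - singularCohomology.map R R f p (gysinMap μY μX f h h y)) = 0 := by
  have hX : μX.HasPoincareDuality :=
    HomologicalOrientation.HasPoincareDuality.of_bijective_poincareDualityMap
      (fun p q h ↦ poincare_duality μX h)
  rw [map_sub, gysinMap_map_of_hasDegree hX hf h, one_smul, sub_self]

omit [CompactSpace Y] [T2Space Y] [ChartedSpace (EuclideanSpace ℝ (Fin n)) Y] in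
/-- **`f_*((y - f^* f_! y) ⌢ [Y]) = 0`**: `f_*(κ ⌢ [Y]) = (f_! κ) ⌢ [X]` (`capProduct_gysinMap`,
Fulton App. B §B.1 (5)) and `f_! κ = 0`. [cite: FultonYoungTableaux1997, Appendix B §B.1 (5)–(7)] -/
theorem map_capProduct_sub_map_gysinMap_eq_zero (μY : HomologicalOrientation R Y n)
    (μX : HomologicalOrientation R X n) (f : C(Y, X)) (hf : HasDegree μY μX f 1) {p q : ℕ}
    (h : p + q = n) (y : singularCohomology R R Y p) :
    singularHomology.map R R f q
      (capProduct h (y - singularCohomology.map R R f p (gysinMap μY μX f h h y))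
        μY.fundamentalClass) = 0 := by
  have hX : μX.HasPoincareDuality :=
    HomologicalOrientation.HasPoincareDuality.of_bijective_poincareDualityMap
      (fun p q h ↦ poincare_duality μX h)
  rw [← capProduct_gysinMap hX f h h, gysinMap_sub_map_gysinMap_eq_zero μY μX f hf h y, map_zero,
    LinearMap.zero_apply]

/-- **Degree-one maps over a homeomorphism locus: `y - f^*(f_! y)` vanishes near every compact
subset of `f⁻¹U`, for every coefficient ring.** Let `f : Y → X` be a map of closed `R`-oriented
`n`-manifolds with `f_* [Y] = [X]`, restricting to a homeomorphism `f⁻¹U ≃ U` over the open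
`U ⊆ X`. For `y ∈ Hᵖ(Y; R)` and a compact `C ⊆ f⁻¹U` there is an open `V ⊇ C` with
`(y - f^* f_! y)|_V = 0`: with `κ = y - f^* f_! y`, `f_*(κ ⌢ [Y]) = 0`, so `j_*(κ ⌢ [Y]) = 0` in
`H_q(Y, Y ∖ C)` (its image under the injective `f_* : H_q(Y, Y ∖ C) → H_q(X, X ∖ f C)` is
`j_* f_*(κ ⌢ [Y]) = 0`), and `κ` dies near `C` by Čech–Poincaré duality along `C` (Hatcher
Thm. 3.44; the tree's `exists_isOpen_map_eq_zero_of_ofAbsolute_capProduct_eq_zero`). This is the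
chain-level content of "proper push-forward commutes with restriction to open subsets" (Fulton,
App. B §B.2 Exercise 5) for the degree-one map `f` over `U`, where `f` is a homeomorphism.
[cite: FultonYoungTableaux1997, Appendix B §B.2 Exercise 5 with (26), (30)]
[cite: Fulton1998, §19.1 and Lemma 19.1.2] [cite: HatcherAT2002, §3.3 Thm. 3.44] -/
theorem exists_isOpen_map_sub_map_gysinMap_eq_zero (μY : HomologicalOrientation R Y n)
    (μX : HomologicalOrientation R X n) (f : C(Y, X)) (hf : HasDegree μY μX f 1) {U : Set X}
    (hU : IsOpen U) (e : ↥(f ⁻¹' U) ≃ₜ ↥U) (he : ∀ y : ↥(f ⁻¹' U), ((e y : ↥U) : X) = f y)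
    {p q : ℕ} (h : p + q = n) (y : singularCohomology R R Y p) {C : Set Y} (hC : IsCompact C)
    (hCU : C ⊆ f ⁻¹' U) :
    ∃ V : Set Y, IsOpen V ∧ C ⊆ V ∧
      singularCohomology.map R R (⟨Subtype.val, continuous_subtype_val⟩ : C(↥V, Y)) p
        (y - singularCohomology.map R R f p (gysinMap μY μX f h h y)) = 0 := by
  set κ := y - singularCohomology.map R R f p (gysinMap μY μX f h h y) with hκ
  have hCcl : IsClosed C := hC.isClosed
  have hfC : IsClosed (f '' C) := (hC.image f.continuous).isClosed
  -- `j_*(κ ⌢ [Y]) = 0 ∈ H_q(Y, Y ∖ C)`, by injectivity of `f_*` on `H_q(Y, Y ∖ C)`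
  have h0 : relativeSingularHomology.ofAbsolute R R Y Cᶜ q (capProduct h κ μY.fundamentalClass) = 0 := by
    apply injective_relMap_of_homeomorph_preimage f hU e he hCcl hCU hfC q
    rw [map_zero, ← ModuleCat.comp_apply, relativeSingularHomology.ofAbsolute_comp_map,
      ModuleCat.comp_apply]
    change relativeSingularHomology.ofAbsolute R R X (f '' C)ᶜ q
      (singularHomology.map R R f q (capProduct h κ μY.fundamentalClass)) = 0
    rw [hκ, map_capProduct_sub_map_gysinMap_eq_zero μY μX f hf h y, map_zero]
  exact exists_isOpen_map_eq_zero_of_ofAbsolute_capProduct_eq_zero μY hCcl h κ h0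

end DegreeOne

/-! ### From "near every compact subset" to "everywhere", over a self-injective ring -/

section Baer

variable {W : Type u} [TopologicalSpace W]

/-- **Over a self-injective ring, a class vanishing near every compact subset vanishes**: for
`R` with `Module.Baer R R` (fields, `ℤ/m`) and `k ∈ Hᵖ(W; R)` such that every compact `C ⊆ W` has
an open neighbourhood `V` with `k|_V = 0`, `k = 0`. Every `σ ∈ Hₚ(W; R)` is carried by a compact
`C` (`singularHomology.exists_isCompact_mem_range_map`), so `⟨k, σ⟩ = ⟨k|_V, σ_V⟩ = 0`, and the
Kronecker map is injective (`kroneckerPairing_injective_of_baer`). [cite: HatcherAT2002, §3.1 Thm. 3.2 and §2.1 Prop. 2.6 (compact carriers)]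
[cite: Lam1999, §3B Thm. 3.7] -/
theorem singularCohomology.eq_zero_of_forall_isCompact_exists_isOpen_map_eq_zero
    (hR : Module.Baer R R) {p : ℕ} (k : singularCohomology R R W p)
    (hk : ∀ C : Set W, IsCompact C → ∃ V : Set W, IsOpen V ∧ C ⊆ V ∧
      singularCohomology.map R R (⟨Subtype.val, continuous_subtype_val⟩ : C(↥V, W)) p k = 0) :
    k = 0 := by
  apply singularCohomology.eq_zero_of_forall_kroneckerPairing_eq_zero_of_baer R W hR p k
  intro σ
  obtain ⟨C₀, hC₀, β, rfl⟩ := singularHomology.exists_isCompact_mem_range_map R R σ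
  obtain ⟨V, -, hCV, hkV⟩ := hk C₀ hC₀
  let g : C(↥C₀, ↥V) := ⟨fun z ↦ ⟨z.1, hCV z.2⟩, by fun_prop⟩
  have e2 : (⟨Subtype.val, continuous_subtype_val⟩ : C(↥C₀, W)) =
      (⟨Subtype.val, continuous_subtype_val⟩ : C(↥V, W)).comp g := by
    ext z
    rfl
  rw [e2, singularHomology.map_comp, ModuleCat.comp_apply, ← kroneckerPairing_map, hkV, map_zero,
    LinearMap.zero_apply]

/-- **Subset form**: over a self-injective `R`, if every compact `C ⊆ W ⊆ Z` has an open
neighbourhood `V` in `Z` with `k|_V = 0`, then `k|_W = 0` (`k ∈ Hᵖ(Z; R)`). [cite: HatcherAT2002, §3.1 Thm. 3.2]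
[cite: Lam1999, §3B Thm. 3.7] -/
theorem singularCohomology.map_subsetIncl_eq_zero_of_forall_isCompact (hR : Module.Baer R R)
    {Z : Type u} [TopologicalSpace Z] {W : Set Z} {p : ℕ} (k : singularCohomology R R Z p)
    (hk : ∀ C : Set Z, IsCompact C → C ⊆ W → ∃ V : Set Z, IsOpen V ∧ C ⊆ V ∧
      singularCohomology.map R R (⟨Subtype.val, continuous_subtype_val⟩ : C(↥V, Z)) p k = 0) :
    singularCohomology.map R R (⟨Subtype.val, continuous_subtype_val⟩ : C(↥W, Z)) p k = 0 := by
  apply singularCohomology.eq_zero_of_forall_isCompact_exists_isOpen_map_eq_zero hR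
  intro C₀ hC₀
  obtain ⟨V, hVo, hCV, hkV⟩ := hk (Subtype.val '' C₀) (hC₀.image continuous_subtype_val)
    (by rintro _ ⟨z, _, rfl⟩; exact z.2)
  refine ⟨Subtype.val ⁻¹' V, hVo.preimage continuous_subtype_val, fun z hz ↦ hCV ⟨z, hz, rfl⟩, ?_⟩
  let g : C(↥(Subtype.val ⁻¹' V : Set ↥W), ↥V) := ⟨fun z ↦ ⟨z.1.1, z.2⟩, by fun_prop⟩
  have e2 : (⟨Subtype.val, continuous_subtype_val⟩ : C(↥W, Z)).comp
      (⟨Subtype.val, continuous_subtype_val⟩ : C(↥(Subtype.val ⁻¹' V : Set ↥W), ↥W)) =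
        (⟨Subtype.val, continuous_subtype_val⟩ : C(↥V, Z)).comp g := by
    ext z
    rfl
  rw [← ModuleCat.comp_apply, ← singularCohomology.map_comp, e2, singularCohomology.map_comp,
    ModuleCat.comp_apply, hkV, map_zero]

variable {n : ℕ} [CompactSpace X] [T2Space X] [ChartedSpace (EuclideanSpace ℝ (Fin n)) X]
  [CompactSpace Y] [T2Space Y] [ChartedSpace (EuclideanSpace ℝ (Fin n)) Y]

/-- **Degree-one maps over a homeomorphism locus, self-injective coefficients:
`(y - f^* f_! y)|_{f⁻¹U} = 0`.** For `f : Y → X` of degree one between closed `R`-oriented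
`n`-manifolds restricting to a homeomorphism `f⁻¹U ≃ U` over the open `U`, `R` self-injective
(fields, `ℤ/m`), and `y ∈ Hᵖ(Y; R)`: `f^*(f_! y)` and `y` agree on `f⁻¹U` — the Gysin map of `f`
is, over `U`, the Gysin map of the homeomorphism `f|` (Fulton, App. B §B.2 Exercise 5 / §19.1
compatibilities), proved here from `exists_isOpen_map_sub_map_gysinMap_eq_zero` and the
Kronecker detection of classes over self-injective rings.
[cite: FultonYoungTableaux1997, Appendix B §B.2 Exercise 5 with (26), (30)] [cite: Fulton1998, Lemma 19.1.2]
[cite: HatcherAT2002, §3.1 Thm. 3.2 and §3.3 Thm. 3.44] -/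
theorem map_sub_map_gysinMap_eq_zero_of_baer (hR : Module.Baer R R)
    (μY : HomologicalOrientation R Y n) (μX : HomologicalOrientation R X n) (f : C(Y, X))
    (hf : HasDegree μY μX f 1) {U : Set X} (hU : IsOpen U) (e : ↥(f ⁻¹' U) ≃ₜ ↥U)
    (he : ∀ y : ↥(f ⁻¹' U), ((e y : ↥U) : X) = f y) {p q : ℕ} (h : p + q = n)
    (y : singularCohomology R R Y p) :
    singularCohomology.map R R (⟨Subtype.val, continuous_subtype_val⟩ : C(↥(f ⁻¹' U), Y)) p
      (y - singularCohomology.map R R f p (gysinMap μY μX f h h y)) = 0 :=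
  singularCohomology.map_subsetIncl_eq_zero_of_forall_isCompact hR _ fun _ hC hCU ↦
    exists_isOpen_map_sub_map_gysinMap_eq_zero μY μX f hf hU e he h y hC hCU

end Baer

/-! ### Integral classes, modulo `m` -/

section Integral

-- `ℤ`, `ℤ/m` and the spaces live in `Type` (the universe constraints of `ringChange_map`); the
-- consumers are complex points of varieties, `X(ℂ) : Type`.
variable {n : ℕ} {X₀ Y₀ : Type} [TopologicalSpace X₀] [CompactSpace X₀] [T2Space X₀]
  [ChartedSpace (EuclideanSpace ℝ (Fin n)) X₀] [TopologicalSpace Y₀] [CompactSpace Y₀] [T2Space Y₀]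
  [ChartedSpace (EuclideanSpace ℝ (Fin n)) Y₀]

/-- **Integral form, modulo `m`: for `ℤ`-orientations, `f` of degree one restricting to a
homeomorphism over the open `U`, and `y ∈ Hᵖ(Y; ℤ)`, the reduction modulo `m ≠ 0` of
`y - f^* f_! y` vanishes on `f⁻¹U`.** (`y - f^* f_! y` vanishes near every compact subset of
`f⁻¹U` integrally, `exists_isOpen_map_sub_map_gysinMap_eq_zero`; reduce modulo `m` —
`singularCohomology.ringChange_map` — and detect over the self-injective `ℤ/m`,
`singularCohomology.map_subsetIncl_eq_zero_of_forall_isCompact` with `ZMod.baer_self`.) Hence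
`y - f^* f_! y` is divisible by every `m` on `f⁻¹U` (Bockstein). Over `ℤ` itself the class
vanishes on `f⁻¹U` (Borel–Moore proper base change, Fulton App. B §B.2 Ex. 5), which the tree
cannot yet express. [cite: FultonYoungTableaux1997, Appendix B §B.2 Exercise 5 with (26), (30)]
[cite: HatcherAT2002, §3.1 Thm. 3.2, §3.3 Thm. 3.44] [cite: Lam1999, §15] -/
theorem ringChange_map_sub_map_gysinMap_eq_zero (μY : HomologicalOrientation ℤ Y₀ n)
    (μX : HomologicalOrientation ℤ X₀ n) (f : C(Y₀, X₀)) (hf : HasDegree μY μX f 1) {U : Set X₀}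
    (hU : IsOpen U) (e : ↥(f ⁻¹' U) ≃ₜ ↥U) (he : ∀ y : ↥(f ⁻¹' U), ((e y : ↥U) : X₀) = f y)
    {p q : ℕ} (h : p + q = n) (y : singularCohomology ℤ ℤ Y₀ p) (m : ℕ) [NeZero m] :
    singularCohomology.map (ZMod m) (ZMod m)
        (⟨Subtype.val, continuous_subtype_val⟩ : C(↥(f ⁻¹' U), Y₀)) p
      (singularCohomology.ringChange (Int.castRingHom (ZMod m)) Y₀ p
        (y - singularCohomology.map ℤ ℤ f p (gysinMap μY μX f h h y))) = 0 := by
  refine singularCohomology.map_subsetIncl_eq_zero_of_forall_isCompact (ZMod.baer_self m) _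
    fun C hC hCU ↦ ?_
  obtain ⟨V, hVo, hCV, hV⟩ := exists_isOpen_map_sub_map_gysinMap_eq_zero μY μX f hf hU e he h y hC hCU
  refine ⟨V, hVo, hCV, ?_⟩
  rw [← singularCohomology.ringChange_map, hV, map_zero]

end Integral

end Literature.AlgebraicTopology.SingularHomology

end
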